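import Literature.AnabelianGeometry.SemiGraphs.ArithThm54EdgelessOuterModel
import HarnessLib

/-!
# [SemiAnbd] Thm 5.4 (ii), cone site `ArithMaximalCompactStatementII.isArithMaximalCompact_of_isVerticial`
# RE-CLOSED at the carriers where Thm 5.4 (ii) AS TYPED has a CLOSED producer (K4 / C-R33, row F-1399)

Mochizuki, *Semi-graphs of anabelioids*, Publ. RIMS **42** (2006), §5 Def 5.3 (i)(iii) p. 65, Thm 5.4 (ii) p. 66
("The arithmetically maximal compact subgroups of `π₁^temp(𝔊)` are precisely the verticial subgroups"), Ex 5.6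
p. 67 (the arithmetic semi-graph of anabelioids of a pointed stable curve; smooth special fibre = one vertex, no
edge), and the author's *Comments* (May 2020) item (4) ("`Π^temp_𝔊` itself is a verticial subgroup … hence
compact … the unique maximal compact subgroup") [cite: MochizukiSemiAnbd2006, Thm 5.4 (ii), p. 66].

PROOF-ONLY companion (abc-iut cell, K4 RE-CLOSE of cone node `SemiAnbd:Thm5.4(ii)`, seat abc-iut-w6-d099 gen 5;
no definition, no instance, no new named fact, nothing restated — DEFS-FREEZE respected).  The cone's closing
theorem for this node, abc-iut-L3-t3's bookkeeping lemma
`ArithMaximalCompactStatementII.isArithMaximalCompact_of_isVerticial (h : ArithMaximalCompactStatementII D aug)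
(hK : IsVerticial D K) : IsArithMaximalCompact aug K` (`ArithMaximalCompact.lean` p403878), BINDS FACT-LIST row
F-1399 `ArithMaximalCompactStatementII` as its hypothesis `h`; the universal closure of that row is REFUTED in
the tree (abc-iut-w5-d095 `not_forall_arithMaximalCompactStatementII`, `ArithMaximalCompactClosures.lean`
p429184), so the node counts as re-closed only against the SURVIVING INSTANCE FORMS of the row.  This file
composes the site BY NAME with each CLOSED producer of the row (abc-iut-c312-2 `CONE-FACT-PRODUCERS.tsv`:
0 assumption-class FACT binders) and states the site's conclusion — "every verticial subgroup is arithmetically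
maximal compact", and concretely "`Π^temp_𝔊 = ⊤` is arithmetically maximal compact" — at those carriers:

* §0 `isArithMaximalCompact_of_isVerticial_of_vertGp_eq_top` / `isArithMaximalCompact_top_of_vertGp_eq_top` —
  Comment (4)'s configuration over abc-iut-f-156's `arithMaximalCompactStatementII_of_vertGp_eq_top`
  (`ArithMaximalCompactTrivialBase.lean` p433xxx lineage): any data all of whose vertex groups are `Π^temp_𝔊`, no
  branches, `Π^temp_𝔊` compact, `⊤` arithmetically ample — for EVERY `Π_A`.
* §1 `isArithMaximalCompact_of_isVerticial_ofChart_affWitness(_outerAction)`,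
  `isArithMaximalCompact_top_ofChart_affWitness_outerAction` — at the PRODUCED decomposition data
  `decompositionDataOfChart R ι` (abc-iut-w4-d053, T54-0) over the tree's Thm-3.7 witness `affWitness p`
  (abc-iut-w5-d212), every chart / representatives / compact `Π^temp_𝔊` / `ι` with normal range / `aug` with open
  image, and at the cell's outer model `π₁^temp(𝒢) ⋊^out Π_A` for EVERY outer action `ρ` and every compact group
  topology on it (producers abc-iut-f-156 `arithMaximalCompactStatementII_ofChart_affWitness(_outerAction)`).
* §2 `isArithMaximalCompact_of_isVerticial_outerModel_of_edgeless`, `isArithMaximalCompact_top_outerModel_of_edgeless`,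
  `isArithMaximalCompact_iff_eq_top_outerModel_of_edgeless` — at the outer model of EVERY one-vertex edgeless `𝒢`
  (print's Ex 5.6 with SMOOTH special fibre), every `ρ`, every compact group topology, every representative with
  `R.Hv v = ⊤` (producer abc-iut-w4-d071 `arithMaximalCompactStatementII_outerModel_of_edgeless`).
* §3 `exists_arithMaximalCompactStatementII_temperedPiChart_of_edgeless` — the Thm 5.4 (ii) twin of abc-iut-w4-d071's
  (i)-only `arithMaximalCompactStatementI_temperedPiChart_of_edgeless`: at the CANONICAL chart
  `𝒢.temperedPiChart h36` of a one-vertex edgeless `𝒢` satisfying `Prop36Hypotheses` a representative with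
  `Hv v = ⊤` EXISTS (`exists_chartRepresentatives_Hv_eq_top_of_edgeless`), so Thm 5.4 (ii) AS TYPED and the site's
  conclusion hold there for EVERY `ρ` in every compact group topology — no residual binder.

HONEST LABEL.  All carriers above are EDGELESS (one vertex): the "in essence vacuous" end of Thm 5.4 named by
Comment (4), generalised from `Π_A = 1` to an arbitrary `Π_A` and outer action `ρ`; there `Π^temp_𝔊` is the unique
verticial subgroup and the unique arithmetically maximal compact subgroup.  The SUBSTANTIVE case (an edge) is NOT
re-closed here: in the tree Thm 5.4 (i) ∧ (ii) at `π₁^temp(𝒢) ⋊^out Π_A` of the characteristic Galois tower is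
abc-iut-w4-d029's CAPSTONE v8 `arithMaximalCompactStatement_outerAction_piPresentation_charCores_of_branchTransport`
(`ArithThm54CharCoresCapstoneV8.lean`), CONDITIONAL on its displayed residual — the DESIGN data `hBR` (branch
transport) and `n₁`/`hCC` (congruence-continuity), the topology pin `hinst`, Thm 5.4's printed frame
`noSwitchBase` and Thm 5.4's OWN hypothesis `hest` (total arithmetic estrangement, row F-1406, itself of refuted
universal closure and read at print's decomposition data) — and the site composes with its second component
verbatim.  Re-closed-at-a-carrier ≠ proved-in-print; typed ≠ proved; no side taken on [IUTchIII] Cor. 3.12.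
-/

namespace Literature.AnabelianGeometry.SemiGraphs

open CategoryTheory Topology
open Literature.AnabelianGeometry.EtaleTheta
open scoped Pointwise

universe u₀ u₀' w₀ w₀' u u'

/-! ### §0  Comment (4)'s configuration: all vertex groups `= Π^temp_𝔊`, no branches -/

section VertGpTop

variable {Gtp : Type u₀} [Group Gtp] [TopologicalSpace Gtp]
variable {PA : Type u₀'} [Group PA] [TopologicalSpace PA]
variable {V : Type w₀} {B : Type w₀'}

/-- **The site re-closed in Comment (4)'s configuration.**  For decomposition data with at least one vertex, all
vertex groups equal to `Π^temp_𝔊`, no branches, `Π^temp_𝔊` compact and `⊤` arithmetically ample (for EVERY `Π_A`),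
every verticial subgroup is arithmetically maximal compact — the cone site
`ArithMaximalCompactStatementII.isArithMaximalCompact_of_isVerticial` with its F-1399 binder SUPPLIED by the closed
producer `arithMaximalCompactStatementII_of_vertGp_eq_top`. [cite: MochizukiSemiAnbd2006, Thm 5.4 (ii), p. 66] -/
theorem isArithMaximalCompact_of_isVerticial_of_vertGp_eq_top [CompactSpace Gtp] [Nonempty V] [IsEmpty B]
    (D : DecompositionData Gtp V B) (aug : Gtp →* PA) (hV : ∀ v : V, D.vertGp v = ⊤)
    (htop : IsArithAmple aug ⊤) {K : Subgroup Gtp} (hK : IsVerticial D K) : IsArithMaximalCompact aug K :=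
  (arithMaximalCompactStatementII_of_vertGp_eq_top D aug hV htop).isArithMaximalCompact_of_isVerticial hK

/-- In that configuration `Π^temp_𝔊 = ⊤` IS a verticial subgroup ("`Π^temp_𝔊` itself is a verticial subgroup",
Comment (4)), hence arithmetically maximal compact ("the unique maximal compact subgroup").
[cite: MochizukiSemiAnbd2006, Thm 5.4 (ii), p. 66] -/
theorem isArithMaximalCompact_top_of_vertGp_eq_top [CompactSpace Gtp] [Nonempty V] [IsEmpty B]
    (D : DecompositionData Gtp V B) (aug : Gtp →* PA) (hV : ∀ v : V, D.vertGp v = ⊤)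
    (htop : IsArithAmple aug ⊤) : IsArithMaximalCompact aug (⊤ : Subgroup Gtp) :=
  isArithMaximalCompact_of_isVerticial_of_vertGp_eq_top D aug hV htop
    ((isVerticial_iff_eq_top_of_vertGp_eq_top D hV ⊤).2 rfl)

end VertGpTop

namespace ProfiniteSemiGraph

/-! ### §1  The produced data over the Thm-3.7 witness `affWitness p` -/

section AffWitness

variable {p : ℕ} [Fact p.Prime] {c : TemperedPiChart (affWitness p)}
variable {Gtp : Type u} [Group Gtp] [TopologicalSpace Gtp]
variable {PA : Type u'} [Group PA] [TopologicalSpace PA]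

/-- **The site re-closed at the produced data over `affWitness p`**: for every chart `c` of the witness, every
compatible choice `R` of §3 representatives, every COMPACT `Π^temp_𝔊 = Gtp`, every `ι : π₁^temp(𝒢) → Gtp` with
normal range and every `aug` with open image, every verticial subgroup of the produced decomposition data
`decompositionDataOfChart R ι` is arithmetically maximal compact (F-1399 binder := abc-iut-f-156's closed producer
`arithMaximalCompactStatementII_ofChart_affWitness`). [cite: MochizukiSemiAnbd2006, Thm 5.4 (ii), p. 66] -/
theorem isArithMaximalCompact_of_isVerticial_ofChart_affWitness [CompactSpace Gtp] (R : ChartRepresentatives c)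
    (ι : c.G →* Gtp) (hn : ι.range.Normal) (aug : Gtp →* PA) (htop : IsArithAmple aug ⊤)
    {K : Subgroup Gtp} (hK : IsVerticial (decompositionDataOfChart R ι) K) : IsArithMaximalCompact aug K :=
  (arithMaximalCompactStatementII_ofChart_affWitness R ι hn aug htop).isArithMaximalCompact_of_isVerticial hK

variable (ρ : PA →* TopOut c.G)

/-- **The site re-closed at the cell's outer model `π₁^temp(𝒢) ⋊^out Π_A` over `affWitness p`**, for EVERY outer
action `ρ : Π_A →* Out(π₁^temp 𝒢)` of any topological group `Π_A` and every COMPACT topology on the outer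
semi-direct product: every verticial subgroup of the produced data is arithmetically maximal compact (F-1399
binder := abc-iut-f-156's closed producer `arithMaximalCompactStatementII_ofChart_affWitness_outerAction`).
[cite: MochizukiSemiAnbd2006, Thm 5.4 (ii), p. 66] -/
theorem isArithMaximalCompact_of_isVerticial_ofChart_affWitness_outerAction
    [TopologicalSpace (outerSemidirectProduct ρ)] [CompactSpace (outerSemidirectProduct ρ)]
    (R : ChartRepresentatives c) {K : Subgroup (outerSemidirectProduct ρ)}
    (hK : IsVerticial (decompositionDataOfChart R (toOuterSemidirectProduct ρ)) K) :
    IsArithMaximalCompact (outerSemidirectProductSnd ρ) K :=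
  (arithMaximalCompactStatementII_ofChart_affWitness_outerAction ρ R).isArithMaximalCompact_of_isVerticial hK

/-- At that outer model `Π^temp_𝔊 = ⊤` is the (unique) verticial subgroup of the produced data, hence
arithmetically maximal compact. [cite: MochizukiSemiAnbd2006, Thm 5.4 (ii), p. 66] -/
theorem isArithMaximalCompact_top_ofChart_affWitness_outerAction
    [TopologicalSpace (outerSemidirectProduct ρ)] [CompactSpace (outerSemidirectProduct ρ)]
    (R : ChartRepresentatives c) :
    IsArithMaximalCompact (outerSemidirectProductSnd ρ) (⊤ : Subgroup (outerSemidirectProduct ρ)) :=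
  haveI := nonempty_vertex_affWitness (p := p)
  isArithMaximalCompact_of_isVerticial_ofChart_affWitness_outerAction ρ R
    ((isVerticial_iff_eq_top_of_vertGp_eq_top _
      (decompositionDataOfChart_vertGp_affWitness_eq_top R _
        (range_normal_of_exact _ _ (range_toOuterSemidirectProduct_eq_ker ρ))) ⊤).2 rfl)

end AffWitness

/-! ### §2  The outer model of a ONE-VERTEX EDGELESS `𝒢` (Ex 5.6, smooth special fibre), every `ρ` -/

section Edgeless

variable {𝒢 : ProfiniteSemiGraph.{u}} {c : TemperedPiChart 𝒢}
variable {PA : Type u} [Group PA] [TopologicalSpace PA] (ρ : PA →* TopOut c.G)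

/-- **The site re-closed at the outer model `π₁^temp(𝒢) ⋊^out Π_A` of a ONE-VERTEX EDGELESS `𝒢`, for EVERY outer
action `ρ`**, every compact group topology on the outer semi-direct product and every chart representative with
`R.Hv v = ⊤`: every verticial subgroup of the produced decomposition data is arithmetically maximal compact
(F-1399 binder := abc-iut-w4-d071's closed producer `arithMaximalCompactStatementII_outerModel_of_edgeless`).
[cite: MochizukiSemiAnbd2006, Thm 5.4 (ii), p. 66] -/
theorem isArithMaximalCompact_of_isVerticial_outerModel_of_edgeless [Subsingleton 𝒢.graph.Vertex]
    [Nonempty 𝒢.graph.Vertex] [IsEmpty 𝒢.graph.Edge] [TopologicalSpace (outerSemidirectProduct ρ)]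
    [CompactSpace (outerSemidirectProduct ρ)] (R : ChartRepresentatives c) (hR : ∀ v, R.Hv v = ⊤)
    {K : Subgroup (outerSemidirectProduct ρ)}
    (hK : IsVerticial (decompositionDataOfChart R (toOuterSemidirectProduct ρ)) K) :
    IsArithMaximalCompact (outerSemidirectProductSnd ρ) K :=
  (arithMaximalCompactStatementII_outerModel_of_edgeless ρ R hR).isArithMaximalCompact_of_isVerticial hK

omit [TopologicalSpace PA] in
/-- At the outer model of a one-vertex edgeless `𝒢` all produced vertex groups are `⊤` (the commensurator of the
normal subgroup `ι(π₁^temp 𝒢)`, abc-iut-f-156's `arithVertGp_eq_top_of_Hv_eq_top`).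
[cite: MochizukiSemiAnbd2006, §5, p. 65] -/
theorem decompositionDataOfChart_vertGp_eq_top_outerModel_of_Hv_eq_top
    (R : ChartRepresentatives c) (hR : ∀ v, R.Hv v = ⊤) :
    ∀ v, (decompositionDataOfChart R (toOuterSemidirectProduct ρ)).vertGp v = ⊤ := fun v => by
  rw [decompositionDataOfChart_vertGp]
  exact arithVertGp_eq_top_of_Hv_eq_top R _ (range_toOuterSemidirectProduct_normal ρ) v (hR v)

/-- **`Π^temp_𝔊 = ⊤` is arithmetically maximal compact** at the outer model of a one-vertex edgeless `𝒢`, for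
every `ρ` and every compact group topology ("the unique maximal compact subgroup", Comment (4); here over an
arbitrary `Π_A`). [cite: MochizukiSemiAnbd2006, Thm 5.4 (ii), p. 66] -/
theorem isArithMaximalCompact_top_outerModel_of_edgeless [Subsingleton 𝒢.graph.Vertex]
    [Nonempty 𝒢.graph.Vertex] [IsEmpty 𝒢.graph.Edge] [TopologicalSpace (outerSemidirectProduct ρ)]
    [CompactSpace (outerSemidirectProduct ρ)] (R : ChartRepresentatives c) (hR : ∀ v, R.Hv v = ⊤) :
    IsArithMaximalCompact (outerSemidirectProductSnd ρ) (⊤ : Subgroup (outerSemidirectProduct ρ)) :=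
  isArithMaximalCompact_of_isVerticial_outerModel_of_edgeless ρ R hR
    ((isVerticial_iff_eq_top_of_vertGp_eq_top _
      (decompositionDataOfChart_vertGp_eq_top_outerModel_of_Hv_eq_top ρ R hR) ⊤).2 rfl)

/-- At the same carrier the arithmetically maximal compact subgroups are EXACTLY `{Π^temp_𝔊}`: `aug` is onto
`Π_A`, so `⊤` is arithmetically ample (abc-iut-f-156's `isArithMaximalCompact_iff_eq_top`).
[cite: MochizukiSemiAnbd2006, Def 5.3 (i), p. 65] -/
theorem isArithMaximalCompact_iff_eq_top_outerModel [TopologicalSpace (outerSemidirectProduct ρ)]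
    [CompactSpace (outerSemidirectProduct ρ)] (K : Subgroup (outerSemidirectProduct ρ)) :
    IsArithMaximalCompact (outerSemidirectProductSnd ρ) K ↔ K = ⊤ :=
  isArithMaximalCompact_iff_eq_top _ (by
    unfold IsArithAmple
    rw [Subgroup.map_top_of_surjective _ (outerSemidirectProductSnd_surjective ρ), Subgroup.coe_top]
    exact isOpen_univ) K

end Edgeless

/-! ### §3  The CANONICAL chart of a one-vertex edgeless `𝒢`: Thm 5.4 (ii) with no residual binder -/

section Canonical

variable {𝒢 : ProfiniteSemiGraph.{u}} (h36 : 𝒢.Prop36Hypotheses)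

/-- **[SemiAnbd] Thm 5.4 (ii) AS TYPED at the CANONICAL outer model `π₁^temp(𝒢) ⋊^out Π_A` of every one-vertex
edgeless `𝒢` satisfying `Prop36Hypotheses`, for EVERY outer action `ρ` and every compact group topology** — the
(ii) twin of abc-iut-w4-d071's `arithMaximalCompactStatementI_temperedPiChart_of_edgeless`: a chart representative
with every `Hv v = ⊤` exists at the canonical chart (`exists_chartRepresentatives_Hv_eq_top_of_edgeless`), and at it
abc-iut-w4-d071's `arithMaximalCompactStatementII_outerModel_of_edgeless` applies; the site's conclusion for `⊤`
rides along.  No residual binder. [cite: MochizukiSemiAnbd2006, Thm 5.4 (ii), p. 66] -/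
theorem exists_arithMaximalCompactStatementII_temperedPiChart_of_edgeless [Subsingleton 𝒢.graph.Vertex]
    [Nonempty 𝒢.graph.Vertex] [IsEmpty 𝒢.graph.Edge]
    (T : ∀ w : 𝒢.graph.Vertex, (𝒢.galoisLevelData h36).PointSeq h36.isCountable w)
    (Rb : SemiGraph.RefBranches 𝒢.graph)
    {PA : Type u} [Group PA] [TopologicalSpace PA] (ρ : PA →* TopOut (𝒢.temperedPiChart h36).G)
    [TopologicalSpace (outerSemidirectProduct ρ)] [CompactSpace (outerSemidirectProduct ρ)] :
    ∃ R : ChartRepresentatives (𝒢.temperedPiChart h36), (∀ v, R.Hv v = ⊤) ∧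
      ArithMaximalCompactStatementII (decompositionDataOfChart R (toOuterSemidirectProduct ρ))
        (outerSemidirectProductSnd ρ) ∧
      IsArithMaximalCompact (outerSemidirectProductSnd ρ) (⊤ : Subgroup (outerSemidirectProduct ρ)) := by
  obtain ⟨R, hR⟩ := exists_chartRepresentatives_Hv_eq_top_of_edgeless h36 T Rb
  exact ⟨R, hR, arithMaximalCompactStatementII_outerModel_of_edgeless ρ R hR,
    isArithMaximalCompact_top_outerModel_of_edgeless ρ R hR⟩

/-- **Thm 5.4 (i) ∧ (ii) AS TYPED together at the canonical outer model of a one-vertex edgeless `𝒢`**, every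
`ρ`, every compact group topology, at one representative `R` (abc-iut-w4-d071's (i) and the (ii) above).
[cite: MochizukiSemiAnbd2006, Thm 5.4, p. 66] -/
theorem exists_arithMaximalCompactStatements_temperedPiChart_of_edgeless [Subsingleton 𝒢.graph.Vertex]
    [Nonempty 𝒢.graph.Vertex] [IsEmpty 𝒢.graph.Edge]
    (T : ∀ w : 𝒢.graph.Vertex, (𝒢.galoisLevelData h36).PointSeq h36.isCountable w)
    (Rb : SemiGraph.RefBranches 𝒢.graph)
    {PA : Type u} [Group PA] [TopologicalSpace PA] (ρ : PA →* TopOut (𝒢.temperedPiChart h36).G)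
    [TopologicalSpace (outerSemidirectProduct ρ)] [CompactSpace (outerSemidirectProduct ρ)] :
    ∃ R : ChartRepresentatives (𝒢.temperedPiChart h36), (∀ v, R.Hv v = ⊤) ∧
      ArithMaximalCompactStatementI (decompositionDataOfChart R (toOuterSemidirectProduct ρ))
        (outerSemidirectProductSnd ρ) ∧
      ArithMaximalCompactStatementII (decompositionDataOfChart R (toOuterSemidirectProduct ρ))
        (outerSemidirectProductSnd ρ) := by
  obtain ⟨R, hR⟩ := exists_chartRepresentatives_Hv_eq_top_of_edgeless h36 T Rb
  exact ⟨R, hR, arithMaximalCompactStatementI_outerModel_of_edgeless ρ R hR,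
    arithMaximalCompactStatementII_outerModel_of_edgeless ρ R hR⟩

end Canonical

end ProfiniteSemiGraph

end Literature.AnabelianGeometry.SemiGraphs
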